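import Summits.QuantumFields.YangMills.Theorems.BalabanUVNodesN12DirectSurjHsurjProxiesLam
import Summits.QuantumFields.YangMills.Theorems.BalabanUVNodesN12TowerProxiesOfClass
import Summits.QuantumFields.YangMills.Theorems.BalabanUVNodesN12SiteProxiesOfClass
import Literature.MathematicalPhysics.QuantumFieldTheory.Balaban1983to89.B15Prop1PlaquetteLettersOfClassB
import HarnessLib

/-!
# BalabanUVNodes ∕ N12 — A RIGHT INVERSE OF `DΨ(0)` FOR PRINT's CHART `msChartB … (lamBondsSeq (maxDomT ν.M₁ Z) k) W U₀` ([II] (2.3)) AT EVERY CLASS MINIMISER — IN PARTICULAR AT THE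
# PRINT MINIMISER — hence `hsurj` there: the print-datum edition of `…N12HsurjOfClass` §1 (✓p705019), by restriction (the second O2 (R)-adapter named by dag-n12-d, pub-ymgap INBOX
# 2026-08-30)

[Balaban1984PropagatorsII] = «[II]», (2.3) p. 224; [Balaban1985Variational] = «[15]», Sect. C (44)–(48) p. 285, (82)–(83) p. 290; [Balaban1988Convergent] = «[III]», (2.2) p. 255,
(2.10)–(2.13) pp. 256–257; [Balaban1987RG1] (0.4) p. 253; [Balaban1989LargeFieldI] Prop. 1 p. 194 (the consumer's proposition).

Cell `pub-ymgap` (HUMAN RULINGS D-0062 ∕ D-0149), WIDTH SEAT `pub-ymgap-dag-n12-w6` g25 (node N12 = [B15]; key K1⁹ `stmt-QuantumFields-27364`, `--kind proof --supports … --as helper`;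
count-neutral).  THEOREMS ONLY (0 `def`, 0 `instance`, 0 `sorry`); composition BY NAME: the per-height (b)-letter `hHB` (= the ∀-body of this seat's g7 (P4)′ proxies edition p678596,
inhabited per height ∕ per `(M₁, Z)` by `…N12HsurjOfClass.exists_hsurjLetters` — UNCHANGED, so every consumer's inhabited letter still fits), fed by the class exactly as in p705019
(dag-n12-c's ρ5b `towerProxies_Bj_of_mem_class`, §3b `siteProxies_Bj_of_mem_class` — class membership only; the B-twin `B15Prop1PlaquetteLettersOfClassB.plaqSmallOn_towerBox_of_isMinimizer`
— minimiser-hood over ANY bond datum), then RESTRICTED to print's rows by this seat's `…N12DirectSurjHsurjProxiesLam.exists_rightInverse_l2_lamBondsSeq_of_genSet` (differentiability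
of the (b)-chart at the base point from the same tower proxies, g7 ρ5c).  Imports green (no `Record13*`).

WHY.  At print's datum the (J0′) ∕ direct-road producers read `hsurj` ∕ the (45) right inverse for the derivative of PRINT's chart at a PRINT minimiser `IsMinimizerB … (lamBondsSeq …) W U₀`
(FLAG №16: a different configuration from the (b)-minimiser in general).  The (b)-socket's hypotheses are facts about the base point `U₀` (class membership, minimiser-hood for the
plaquette letter) and NOT about the constraint set, and they hold at a print minimiser verbatim (the B-twin plaquette letter takes `IsMinimizerB` over any `𝔅'`); the (b)-chart at the
spliced datum is differentiable there; so the right inverse for print's chart is the restricted one (⚑ LOCATED-RESTRICT) — no re-proof of the back-substitution.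

CONTENTS (namespace `Summit.QuantumFields.YangMills.BalabanUVNodes.N12HsurjOfClassLam`): ★★★ `exists_rightInverse_lamBondsSeq_of_isMinimizerB_class` (p705019 §1's hypotheses with
`hmin : IsMinimizerB … 𝔅' W' U₀` for ANY bond datum, `0 ≤ B` displayed, base-point row `AgreeOn (Bj ν.M₁ Z k) (M˙U₀) W`; conclusion over `msChartB … (lamBondsSeq (maxDomT ν.M₁ Z) k) W U₀`),
★★★ `…_of_agreeOnB` (base-point row in print currency `AgreeOnB (lamBondsSeq …) (M˙U₀) W`), ★★★ `exists_rightInverse_lamBondsSeq_atPrintMinimiser` (`hmin : IsMinimizerB … (lamBondsSeq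
(maxDomT ν.M₁ Z) k) W U₀` ⟹ at the chart of its own datum), ★★ `surjective_fderiv_msChartB_lamBondsSeq_of_isMinimizerB_class_of_agreeOnB`, ★★ `surjective_fderiv_msChartB_lamBondsSeq_atPrintMinimiser`,
★★ `surjective_fderiv_msChartB_lamBondsSeq_of_isMinimizerB_class` (at the chart of record `W := M˙U₀`).

HONEST FRAMING.  Composition by name; per-height ∕ per-`(M₁,Z)` EXISTENCE constants (print's volume-uniform (46) NOT claimed); existence ∕ uniqueness of the print minimiser is NOT
asserted (it is the hypothesis `hmin`; FLAG №16's content untouched); nothing of Bałaban's estimates asserted or refuted; count-neutral helper; N12 NOT discharged; K0⁷∕K1⁹ NOT closed; counts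
of record unmoved; one finite 𝕋⁴ programme at fixed ε — R4 closes only the conditional rung `BalabanLadder.UV`; no summit statement is proved here and NOT the Yang–Mills mass gap (Clay);
nothing continuum ∕ ℝ⁴ ∕ OS.
-/

noncomputable section

namespace Summit.QuantumFields.YangMills.BalabanUVNodes.N12HsurjOfClassLam

open scoped BigOperators Matrix.Norms.L2Operator Topology
open Literature.MathematicalPhysics.QuantumFieldTheory.Balaban1983to89
open T4Continuum
open B15DeterminingSets B15DeterminingSetsB GaugeField
open T4AdjointCovarianceUnitary (lieSU)
open Node00
open T4CubeChartGnomonic (SU2)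
open B14.Eq213DetSet (Bj maxDomT)
open B14.Eq213MaximalDomains (side)
open B14.Eq216Concrete (feeds)
open B5Eq118OneStroke (iterBlockOf)
open B15Eq112TorusCover (lift)
open T4AxialGaugeSmallField (boxPlaqs)
open T4ReflectionCone (three_le_L)
open Summit.QuantumFields.YangMills.BalabanUVNodes.N12TowerProxiesOfClass (towerProxies_Bj_of_mem_class)
open Summit.QuantumFields.YangMills.BalabanUVNodes.N12SiteProxiesOfClass (siteProxies_Bj_of_mem_class)
open Summit.QuantumFields.YangMills.BalabanUVNodes.N12DirectSurjHsurjProxiesPrelim (differentiableAt_msChart_of_towerProxies)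
open Summit.QuantumFields.YangMills.BalabanUVNodes.N12DirectSurjHsurjProxiesLam (exists_rightInverse_l2_lamBondsSeq_of_genSet exists_datum_agreeOn_of_agreeOnB msChartB_congr_datum)
open B15Prop1PlaquetteLettersOfClassB (plaqSmallOn_towerBox_of_isMinimizer)

variable {F : T4Family} {k : ℕ}

/-! ## §1  A right inverse of `D(msChartB … (lamBondsSeq (maxDomT ν.M₁ Z) k) W U₀)(0)` — hence `hsurj` — for every class minimiser over any bond datum, from the class -/

/-- ★★★ **A RIGHT INVERSE OF `DΨ(0)` FOR PRINT's CHART AT EVERY CLASS MINIMISER OVER ANY BOND DATUM.**  `…N12HsurjOfClass.exists_rightInverse_Bj_of_isMinimizer_class` (p705019) with: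
(a) the minimiser read as `IsMinimizerB … 𝔅' W' U₀` for ANY bond-level datum `𝔅'` ([II] (2.3)'s `lamBondsSeq …` included; only class membership and minimiser-hood are read); (b) `0 ≤ B`
displayed (inhabited with the letter by `exists_hsurjLetters`); (c) the CONCLUSION over print's chart — `H : 𝔰𝔲(2)^{#print rows} → (bonds → 𝔰𝔲(2))` with
`D(msChartB F 2 Kt k (lamBondsSeq (maxDomT ν.M₁ Z) k) W U₀)(0) ∘ H = id` and `√(Σ_b ‖H v b‖²) ≤ B‖v‖`.  The per-height letter `hHB` is p678596's ∀-body VERBATIM (the (b)-socket), `hsbU` and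
the floors as in p705019; the base-point row is the (b)-fibre row `AgreeOn (Bj ν.M₁ Z k) (M˙U₀) W` (print-currency editions below).  Proof: proxies from the class (ρ5b, §3b), plaquette
letter from minimiser-hood (B-twin), the (b)-socket's `H`, then restriction to print's rows (`…HsurjProxiesLam` §1; differentiability from the tower proxies).
[cite: Balaban1984PropagatorsII, (2.3) p.224; Balaban1985Variational, Sect. C (44)–(48) p.285, (82)–(83) p.290; Balaban1988Convergent, (2.2) p.255, (2.10)–(2.13) pp.256–257; Balaban1987RG1, (0.4) p.253] -/
theorem exists_rightInverse_lamBondsSeq_of_isMinimizerB_class (ν : Node00.Stage7Numerics) (Kt : ℕ) (Z : Set (Site (F.P Kt) 0))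
    (hkK : k + 1 ≤ (F.P Kt).m + (F.P Kt).K) (hM4 : 4 * (F.P Kt).L ≤ ν.M₁) (hdiv : side (F.P Kt).L ν.M₁ k ∣ (F.P Kt).sitesPerDir 0) (hε : 0 ≤ ν.εreg)
    -- per-HEIGHT letters: the near-flat radius of the (0.4) guards (dag-n12-w4), used on the box proxies only
    {ρ'' : ℝ} (hsbU : ∀ V : GaugeField (F.P Kt) 0 SU2, ‖coeField V - 1‖ ≤ ρ'' → SmallBelow (avOfRecord F 2 Kt) k V)
    (hερ : 6 * ((((F.P Kt).d - 1 : ℕ)) : ℝ) * (F.P Kt).L * ν.εreg ≤ ρ'')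
    -- per-HEIGHT ∕ per-`(M₁, Z)` letter: the ∀-body of this lineage's (P4)′ proxies edition `exists_rightInverse_letter_of_proxies` (p678596) at `(εH, B)` — the (b)-SOCKET, unchanged
    {εH B : ℝ}
    (hHB : ∀ (Wd : MSField (F.P Kt) SU2) (U₀ : GaugeField (F.P Kt) 0 SU2),
      AgreeOn (Bj ν.M₁ Z k) (avgFamily (avOfRecord F 2 Kt) U₀) Wd →
      (∀ i' : Fin (constrCard (Bj ν.M₁ Z k) k), ∃ U' : GaugeField (F.P Kt) 0 SU2,
        (∀ b ∈ feeds (((constrEnum (Bj ν.M₁ Z k) k).symm i').1 : ℕ) ((constrEnum (Bj ν.M₁ Z k) k).symm i').2.1, U' b = U₀ b) ∧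
          SmallBelow (avOfRecord F 2 Kt) k U') →
      (∀ (j : ℕ), 1 ≤ j → j ≤ k → ∀ y : Site (F.P Kt) j, embIter j y ∈ maxDomT ν.M₁ Z j → ∃ U' : GaugeField (F.P Kt) 0 SU2,
        (∀ c : PBond (F.P Kt) j, (c.src = y ∨ c.tgt = y) → ∀ b₀ : PBond (F.P Kt) 0,
          (iterBlockOf j b₀.src = c.src ∨ iterBlockOf j b₀.src = c.tgt) → (iterBlockOf j b₀.tgt = c.src ∨ iterBlockOf j b₀.tgt = c.tgt) → U' b₀ = U₀ b₀) ∧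
        SmallBelow (avOfRecord F 2 Kt) k U') →
      (∀ (j : ℕ), 1 ≤ j → j ≤ k → ∀ y : Site (F.P Kt) j, embIter j y ∈ maxDomT ν.M₁ Z j →
        PlaqSmallOn (boxPlaqs (fun κ => lift (F.P Kt) (embIter j y) κ - ((((F.P Kt).L ^ j : ℕ) : ℤ) + ((((F.P Kt).L ^ j - 1) / 2 : ℕ) : ℤ)))
          (fun κ => lift (F.P Kt) (embIter j y) κ + ((((F.P Kt).L ^ j : ℕ) : ℤ) + ((((F.P Kt).L ^ j - 1) / 2 : ℕ) : ℤ))) : Set (Plaq (F.P Kt) 0)) εH U₀) →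
      ∃ H : (Fin (constrCard (Bj ν.M₁ Z k) k) → lieSU (Fin 2)) → PBond (F.P Kt) 0 → lieSU (Fin 2),
        (∀ v, fderiv ℝ (msChart F 2 Kt k (Bj ν.M₁ Z k) Wd U₀) 0 (H v) = v) ∧ ∀ v, Real.sqrt (∑ b, ‖H v b‖ ^ 2) ≤ B * ‖v‖)
    (hεH : ν.εreg ≤ εH)
    -- the minimiser over ANY bond datum: only its class membership and minimiser-hood are read
    {𝔅' : BDetSet (F.P Kt)} {W' : MSField (F.P Kt) SU2} {U₀ : GaugeField (F.P Kt) 0 SU2}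
    (hmin : IsMinimizerB (avOfRecord F 2 Kt) (regMSCoPOfRecord F 2 ν Kt k (maxDomT ν.M₁ Z)) 𝔅' W' U₀)
    {W : MSField (F.P Kt) SU2} (hW : AgreeOn (Bj ν.M₁ Z k) (avgFamily (avOfRecord F 2 Kt) U₀) W) :
    ∃ H : (Fin (constrCardB (lamBondsSeq (maxDomT ν.M₁ Z) k) k) → lieSU (Fin 2)) → PBond (F.P Kt) 0 → lieSU (Fin 2),
      (∀ v, fderiv ℝ (msChartB F 2 Kt k (lamBondsSeq (maxDomT ν.M₁ Z) k) W U₀) 0 (H v) = v) ∧ ∀ v, Real.sqrt (∑ b, ‖H v b‖ ^ 2) ≤ B * ‖v‖ := by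
  have hL := three_le_L (F.P Kt)
  have hM2 : 2 ≤ ν.M₁ := by omega
  have hrad : (F.P Kt).L + ((F.P Kt).L - 1) / 2 ≤ ν.M₁ := by omega
  have hprox := towerProxies_Bj_of_mem_class ν Kt Z hkK hM4 hdiv hε hsbU hερ hmin.mem_reg
  obtain ⟨H, hH, hHB'⟩ := hHB W U₀ hW hprox (siteProxies_Bj_of_mem_class ν Kt Z hkK hM4 hdiv hε hsbU hερ hmin.mem_reg)
    fun j hj1 hjk y hy => plaqSmallOn_towerBox_of_isMinimizer ν Kt Z hmin hM2 hrad hdiv hε hεH hj1 hjk y hy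
  have hd : DifferentiableAt ℝ (msChart F 2 Kt k (Bj ν.M₁ Z k) W U₀) 0 :=
    differentiableAt_msChart_of_towerProxies (Nat.le_of_succ_le hkK) hW hprox
  exact exists_rightInverse_l2_lamBondsSeq_of_genSet (Ω := maxDomT ν.M₁ Z) hd hH hHB'

/-- ★★★ **THE SAME, BASE-POINT ROW IN PRINT CURRENCY**: `AgreeOnB (lamBondsSeq (maxDomT ν.M₁ Z) k) (M˙U₀) W` in place of the (b)-fibre row (splice the datum: `W` on print's bonds,
`M˙U₀` elsewhere — a (b)-fibre base point with the same print chart, `…HsurjProxiesLam` §2). [cite: Balaban1984PropagatorsII, (2.3) p.224; Balaban1985Variational, Sect. C (44)–(48) p.285, (82)–(83) p.290; Balaban1988Convergent, (2.10)–(2.13) pp.256–257] -/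
theorem exists_rightInverse_lamBondsSeq_of_isMinimizerB_class_of_agreeOnB (ν : Node00.Stage7Numerics) (Kt : ℕ) (Z : Set (Site (F.P Kt) 0))
    (hkK : k + 1 ≤ (F.P Kt).m + (F.P Kt).K) (hM4 : 4 * (F.P Kt).L ≤ ν.M₁) (hdiv : side (F.P Kt).L ν.M₁ k ∣ (F.P Kt).sitesPerDir 0) (hε : 0 ≤ ν.εreg)
    {ρ'' : ℝ} (hsbU : ∀ V : GaugeField (F.P Kt) 0 SU2, ‖coeField V - 1‖ ≤ ρ'' → SmallBelow (avOfRecord F 2 Kt) k V)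
    (hερ : 6 * ((((F.P Kt).d - 1 : ℕ)) : ℝ) * (F.P Kt).L * ν.εreg ≤ ρ'')
    {εH B : ℝ}
    (hHB : ∀ (Wd : MSField (F.P Kt) SU2) (U₀ : GaugeField (F.P Kt) 0 SU2),
      AgreeOn (Bj ν.M₁ Z k) (avgFamily (avOfRecord F 2 Kt) U₀) Wd →
      (∀ i' : Fin (constrCard (Bj ν.M₁ Z k) k), ∃ U' : GaugeField (F.P Kt) 0 SU2,
        (∀ b ∈ feeds (((constrEnum (Bj ν.M₁ Z k) k).symm i').1 : ℕ) ((constrEnum (Bj ν.M₁ Z k) k).symm i').2.1, U' b = U₀ b) ∧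
          SmallBelow (avOfRecord F 2 Kt) k U') →
      (∀ (j : ℕ), 1 ≤ j → j ≤ k → ∀ y : Site (F.P Kt) j, embIter j y ∈ maxDomT ν.M₁ Z j → ∃ U' : GaugeField (F.P Kt) 0 SU2,
        (∀ c : PBond (F.P Kt) j, (c.src = y ∨ c.tgt = y) → ∀ b₀ : PBond (F.P Kt) 0,
          (iterBlockOf j b₀.src = c.src ∨ iterBlockOf j b₀.src = c.tgt) → (iterBlockOf j b₀.tgt = c.src ∨ iterBlockOf j b₀.tgt = c.tgt) → U' b₀ = U₀ b₀) ∧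
        SmallBelow (avOfRecord F 2 Kt) k U') →
      (∀ (j : ℕ), 1 ≤ j → j ≤ k → ∀ y : Site (F.P Kt) j, embIter j y ∈ maxDomT ν.M₁ Z j →
        PlaqSmallOn (boxPlaqs (fun κ => lift (F.P Kt) (embIter j y) κ - ((((F.P Kt).L ^ j : ℕ) : ℤ) + ((((F.P Kt).L ^ j - 1) / 2 : ℕ) : ℤ)))
          (fun κ => lift (F.P Kt) (embIter j y) κ + ((((F.P Kt).L ^ j : ℕ) : ℤ) + ((((F.P Kt).L ^ j - 1) / 2 : ℕ) : ℤ))) : Set (Plaq (F.P Kt) 0)) εH U₀) →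
      ∃ H : (Fin (constrCard (Bj ν.M₁ Z k) k) → lieSU (Fin 2)) → PBond (F.P Kt) 0 → lieSU (Fin 2),
        (∀ v, fderiv ℝ (msChart F 2 Kt k (Bj ν.M₁ Z k) Wd U₀) 0 (H v) = v) ∧ ∀ v, Real.sqrt (∑ b, ‖H v b‖ ^ 2) ≤ B * ‖v‖)
    (hεH : ν.εreg ≤ εH)
    {𝔅' : BDetSet (F.P Kt)} {W' : MSField (F.P Kt) SU2} {U₀ : GaugeField (F.P Kt) 0 SU2}
    (hmin : IsMinimizerB (avOfRecord F 2 Kt) (regMSCoPOfRecord F 2 ν Kt k (maxDomT ν.M₁ Z)) 𝔅' W' U₀)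
    {W : MSField (F.P Kt) SU2} (hW : AgreeOnB (lamBondsSeq (maxDomT ν.M₁ Z) k) (avgFamily (avOfRecord F 2 Kt) U₀) W) :
    ∃ H : (Fin (constrCardB (lamBondsSeq (maxDomT ν.M₁ Z) k) k) → lieSU (Fin 2)) → PBond (F.P Kt) 0 → lieSU (Fin 2),
      (∀ v, fderiv ℝ (msChartB F 2 Kt k (lamBondsSeq (maxDomT ν.M₁ Z) k) W U₀) 0 (H v) = v) ∧ ∀ v, Real.sqrt (∑ b, ‖H v b‖ ^ 2) ≤ B * ‖v‖ := by
  obtain ⟨W'', hU'', hW''⟩ := exists_datum_agreeOn_of_agreeOnB (F := F) (N := 2) (K := Kt) (k := k) (Ω := maxDomT ν.M₁ Z) hW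
  obtain ⟨H, hH, hHB'⟩ := exists_rightInverse_lamBondsSeq_of_isMinimizerB_class ν Kt Z hkK hM4 hdiv hε hsbU hερ hHB hεH hmin hU''
  refine ⟨H, fun v => ?_, hHB'⟩
  rw [← msChartB_congr_datum (W' := W'') (W := W) fun j _ c hc => hW'' j c hc]
  exact hH v

/-- ★★★ **AT THE PRINT MINIMISER, AT THE CHART OF ITS OWN DATUM**: for a (2.12) minimiser `U₀` of the PRINT-constrained problem `IsMinimizerB … (lamBondsSeq (maxDomT ν.M₁ Z) k) W U₀` over the
class of record, a right inverse of `D(msChartB F 2 Kt k (lamBondsSeq (maxDomT ν.M₁ Z) k) W U₀)(0)` with `√(Σ_b ‖H v b‖²) ≤ B‖v‖` — the (45) row of the (J0′) ∕ direct-road producers at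
print's datum; per-height letters `hHB` (the (b)-socket, unchanged), `hsbU`, floors and `0 ≤ B`-free as above. [cite: Balaban1984PropagatorsII, (2.3) p.224; Balaban1985Variational, Sect. C (44)–(48) p.285, (82)–(83) p.290; Balaban1988Convergent, (2.10)–(2.13) pp.256–257; Balaban1989LargeFieldI, Prop. 1 p.194] -/
theorem exists_rightInverse_lamBondsSeq_atPrintMinimiser (ν : Node00.Stage7Numerics) (Kt : ℕ) (Z : Set (Site (F.P Kt) 0))
    (hkK : k + 1 ≤ (F.P Kt).m + (F.P Kt).K) (hM4 : 4 * (F.P Kt).L ≤ ν.M₁) (hdiv : side (F.P Kt).L ν.M₁ k ∣ (F.P Kt).sitesPerDir 0) (hε : 0 ≤ ν.εreg)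
    {ρ'' : ℝ} (hsbU : ∀ V : GaugeField (F.P Kt) 0 SU2, ‖coeField V - 1‖ ≤ ρ'' → SmallBelow (avOfRecord F 2 Kt) k V)
    (hερ : 6 * ((((F.P Kt).d - 1 : ℕ)) : ℝ) * (F.P Kt).L * ν.εreg ≤ ρ'')
    {εH B : ℝ}
    (hHB : ∀ (Wd : MSField (F.P Kt) SU2) (U₀ : GaugeField (F.P Kt) 0 SU2),
      AgreeOn (Bj ν.M₁ Z k) (avgFamily (avOfRecord F 2 Kt) U₀) Wd →
      (∀ i' : Fin (constrCard (Bj ν.M₁ Z k) k), ∃ U' : GaugeField (F.P Kt) 0 SU2,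
        (∀ b ∈ feeds (((constrEnum (Bj ν.M₁ Z k) k).symm i').1 : ℕ) ((constrEnum (Bj ν.M₁ Z k) k).symm i').2.1, U' b = U₀ b) ∧
          SmallBelow (avOfRecord F 2 Kt) k U') →
      (∀ (j : ℕ), 1 ≤ j → j ≤ k → ∀ y : Site (F.P Kt) j, embIter j y ∈ maxDomT ν.M₁ Z j → ∃ U' : GaugeField (F.P Kt) 0 SU2,
        (∀ c : PBond (F.P Kt) j, (c.src = y ∨ c.tgt = y) → ∀ b₀ : PBond (F.P Kt) 0,
          (iterBlockOf j b₀.src = c.src ∨ iterBlockOf j b₀.src = c.tgt) → (iterBlockOf j b₀.tgt = c.src ∨ iterBlockOf j b₀.tgt = c.tgt) → U' b₀ = U₀ b₀) ∧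
        SmallBelow (avOfRecord F 2 Kt) k U') →
      (∀ (j : ℕ), 1 ≤ j → j ≤ k → ∀ y : Site (F.P Kt) j, embIter j y ∈ maxDomT ν.M₁ Z j →
        PlaqSmallOn (boxPlaqs (fun κ => lift (F.P Kt) (embIter j y) κ - ((((F.P Kt).L ^ j : ℕ) : ℤ) + ((((F.P Kt).L ^ j - 1) / 2 : ℕ) : ℤ)))
          (fun κ => lift (F.P Kt) (embIter j y) κ + ((((F.P Kt).L ^ j : ℕ) : ℤ) + ((((F.P Kt).L ^ j - 1) / 2 : ℕ) : ℤ))) : Set (Plaq (F.P Kt) 0)) εH U₀) →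
      ∃ H : (Fin (constrCard (Bj ν.M₁ Z k) k) → lieSU (Fin 2)) → PBond (F.P Kt) 0 → lieSU (Fin 2),
        (∀ v, fderiv ℝ (msChart F 2 Kt k (Bj ν.M₁ Z k) Wd U₀) 0 (H v) = v) ∧ ∀ v, Real.sqrt (∑ b, ‖H v b‖ ^ 2) ≤ B * ‖v‖)
    (hεH : ν.εreg ≤ εH)
    {W : MSField (F.P Kt) SU2} {U₀ : GaugeField (F.P Kt) 0 SU2}
    (hmin : IsMinimizerB (avOfRecord F 2 Kt) (regMSCoPOfRecord F 2 ν Kt k (maxDomT ν.M₁ Z)) (lamBondsSeq (maxDomT ν.M₁ Z) k) W U₀) :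
    ∃ H : (Fin (constrCardB (lamBondsSeq (maxDomT ν.M₁ Z) k) k) → lieSU (Fin 2)) → PBond (F.P Kt) 0 → lieSU (Fin 2),
      (∀ v, fderiv ℝ (msChartB F 2 Kt k (lamBondsSeq (maxDomT ν.M₁ Z) k) W U₀) 0 (H v) = v) ∧ ∀ v, Real.sqrt (∑ b, ‖H v b‖ ^ 2) ≤ B * ‖v‖ :=
  exists_rightInverse_lamBondsSeq_of_isMinimizerB_class_of_agreeOnB ν Kt Z hkK hM4 hdiv hε hsbU hερ hHB hεH hmin hmin.agreeOnB

/-! ## §2  `hsurj` for print's chart -/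

/-- ★★ **`hsurj` FOR PRINT's CHART, BASE-POINT ROW IN PRINT CURRENCY**: at every class minimiser `U₀` over any bond datum and every datum `W` with `AgreeOnB (lamBondsSeq (maxDomT ν.M₁ Z) k) (M˙U₀) W`,
`fderiv ℝ (msChartB F 2 Kt k (lamBondsSeq (maxDomT ν.M₁ Z) k) W U₀) 0` is onto. [cite: Balaban1984PropagatorsII, (2.3) p.224; Balaban1985Variational, Sect. C (44)–(48) p.285, (82)–(83) p.290; Balaban1988Convergent, (2.10)–(2.13) pp.256–257] -/
theorem surjective_fderiv_msChartB_lamBondsSeq_of_isMinimizerB_class_of_agreeOnB (ν : Node00.Stage7Numerics) (Kt : ℕ) (Z : Set (Site (F.P Kt) 0))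
    (hkK : k + 1 ≤ (F.P Kt).m + (F.P Kt).K) (hM4 : 4 * (F.P Kt).L ≤ ν.M₁) (hdiv : side (F.P Kt).L ν.M₁ k ∣ (F.P Kt).sitesPerDir 0) (hε : 0 ≤ ν.εreg)
    {ρ'' : ℝ} (hsbU : ∀ V : GaugeField (F.P Kt) 0 SU2, ‖coeField V - 1‖ ≤ ρ'' → SmallBelow (avOfRecord F 2 Kt) k V)
    (hερ : 6 * ((((F.P Kt).d - 1 : ℕ)) : ℝ) * (F.P Kt).L * ν.εreg ≤ ρ'')
    {εH B : ℝ}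
    (hHB : ∀ (Wd : MSField (F.P Kt) SU2) (U₀ : GaugeField (F.P Kt) 0 SU2),
      AgreeOn (Bj ν.M₁ Z k) (avgFamily (avOfRecord F 2 Kt) U₀) Wd →
      (∀ i' : Fin (constrCard (Bj ν.M₁ Z k) k), ∃ U' : GaugeField (F.P Kt) 0 SU2,
        (∀ b ∈ feeds (((constrEnum (Bj ν.M₁ Z k) k).symm i').1 : ℕ) ((constrEnum (Bj ν.M₁ Z k) k).symm i').2.1, U' b = U₀ b) ∧
          SmallBelow (avOfRecord F 2 Kt) k U') →
      (∀ (j : ℕ), 1 ≤ j → j ≤ k → ∀ y : Site (F.P Kt) j, embIter j y ∈ maxDomT ν.M₁ Z j → ∃ U' : GaugeField (F.P Kt) 0 SU2,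
        (∀ c : PBond (F.P Kt) j, (c.src = y ∨ c.tgt = y) → ∀ b₀ : PBond (F.P Kt) 0,
          (iterBlockOf j b₀.src = c.src ∨ iterBlockOf j b₀.src = c.tgt) → (iterBlockOf j b₀.tgt = c.src ∨ iterBlockOf j b₀.tgt = c.tgt) → U' b₀ = U₀ b₀) ∧
        SmallBelow (avOfRecord F 2 Kt) k U') →
      (∀ (j : ℕ), 1 ≤ j → j ≤ k → ∀ y : Site (F.P Kt) j, embIter j y ∈ maxDomT ν.M₁ Z j →
        PlaqSmallOn (boxPlaqs (fun κ => lift (F.P Kt) (embIter j y) κ - ((((F.P Kt).L ^ j : ℕ) : ℤ) + ((((F.P Kt).L ^ j - 1) / 2 : ℕ) : ℤ)))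
          (fun κ => lift (F.P Kt) (embIter j y) κ + ((((F.P Kt).L ^ j : ℕ) : ℤ) + ((((F.P Kt).L ^ j - 1) / 2 : ℕ) : ℤ))) : Set (Plaq (F.P Kt) 0)) εH U₀) →
      ∃ H : (Fin (constrCard (Bj ν.M₁ Z k) k) → lieSU (Fin 2)) → PBond (F.P Kt) 0 → lieSU (Fin 2),
        (∀ v, fderiv ℝ (msChart F 2 Kt k (Bj ν.M₁ Z k) Wd U₀) 0 (H v) = v) ∧ ∀ v, Real.sqrt (∑ b, ‖H v b‖ ^ 2) ≤ B * ‖v‖)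
    (hεH : ν.εreg ≤ εH)
    {𝔅' : BDetSet (F.P Kt)} {W' : MSField (F.P Kt) SU2} {U₀ : GaugeField (F.P Kt) 0 SU2}
    (hmin : IsMinimizerB (avOfRecord F 2 Kt) (regMSCoPOfRecord F 2 ν Kt k (maxDomT ν.M₁ Z)) 𝔅' W' U₀)
    {W : MSField (F.P Kt) SU2} (hW : AgreeOnB (lamBondsSeq (maxDomT ν.M₁ Z) k) (avgFamily (avOfRecord F 2 Kt) U₀) W) :
    Function.Surjective (fderiv ℝ (msChartB F 2 Kt k (lamBondsSeq (maxDomT ν.M₁ Z) k) W U₀) 0) := by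
  obtain ⟨H, hH, -⟩ := exists_rightInverse_lamBondsSeq_of_isMinimizerB_class_of_agreeOnB ν Kt Z hkK hM4 hdiv hε hsbU hερ hHB hεH hmin hW
  exact fun v => ⟨H v, hH v⟩

/-- ★★ **`hsurj` AT THE PRINT MINIMISER, AT THE CHART OF ITS OWN DATUM**: `fderiv ℝ (msChartB F 2 Kt k (lamBondsSeq (maxDomT ν.M₁ Z) k) W U₀) 0` is onto for a print-constrained class
minimiser `IsMinimizerB … (lamBondsSeq (maxDomT ν.M₁ Z) k) W U₀`. [cite: Balaban1984PropagatorsII, (2.3) p.224; Balaban1985Variational, Sect. C (44)–(48) p.285, (82)–(83) p.290; Balaban1988Convergent, (2.10)–(2.13) pp.256–257] -/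
theorem surjective_fderiv_msChartB_lamBondsSeq_atPrintMinimiser (ν : Node00.Stage7Numerics) (Kt : ℕ) (Z : Set (Site (F.P Kt) 0))
    (hkK : k + 1 ≤ (F.P Kt).m + (F.P Kt).K) (hM4 : 4 * (F.P Kt).L ≤ ν.M₁) (hdiv : side (F.P Kt).L ν.M₁ k ∣ (F.P Kt).sitesPerDir 0) (hε : 0 ≤ ν.εreg)
    {ρ'' : ℝ} (hsbU : ∀ V : GaugeField (F.P Kt) 0 SU2, ‖coeField V - 1‖ ≤ ρ'' → SmallBelow (avOfRecord F 2 Kt) k V)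
    (hερ : 6 * ((((F.P Kt).d - 1 : ℕ)) : ℝ) * (F.P Kt).L * ν.εreg ≤ ρ'')
    {εH B : ℝ}
    (hHB : ∀ (Wd : MSField (F.P Kt) SU2) (U₀ : GaugeField (F.P Kt) 0 SU2),
      AgreeOn (Bj ν.M₁ Z k) (avgFamily (avOfRecord F 2 Kt) U₀) Wd →
      (∀ i' : Fin (constrCard (Bj ν.M₁ Z k) k), ∃ U' : GaugeField (F.P Kt) 0 SU2,
        (∀ b ∈ feeds (((constrEnum (Bj ν.M₁ Z k) k).symm i').1 : ℕ) ((constrEnum (Bj ν.M₁ Z k) k).symm i').2.1, U' b = U₀ b) ∧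
          SmallBelow (avOfRecord F 2 Kt) k U') →
      (∀ (j : ℕ), 1 ≤ j → j ≤ k → ∀ y : Site (F.P Kt) j, embIter j y ∈ maxDomT ν.M₁ Z j → ∃ U' : GaugeField (F.P Kt) 0 SU2,
        (∀ c : PBond (F.P Kt) j, (c.src = y ∨ c.tgt = y) → ∀ b₀ : PBond (F.P Kt) 0,
          (iterBlockOf j b₀.src = c.src ∨ iterBlockOf j b₀.src = c.tgt) → (iterBlockOf j b₀.tgt = c.src ∨ iterBlockOf j b₀.tgt = c.tgt) → U' b₀ = U₀ b₀) ∧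
        SmallBelow (avOfRecord F 2 Kt) k U') →
      (∀ (j : ℕ), 1 ≤ j → j ≤ k → ∀ y : Site (F.P Kt) j, embIter j y ∈ maxDomT ν.M₁ Z j →
        PlaqSmallOn (boxPlaqs (fun κ => lift (F.P Kt) (embIter j y) κ - ((((F.P Kt).L ^ j : ℕ) : ℤ) + ((((F.P Kt).L ^ j - 1) / 2 : ℕ) : ℤ)))
          (fun κ => lift (F.P Kt) (embIter j y) κ + ((((F.P Kt).L ^ j : ℕ) : ℤ) + ((((F.P Kt).L ^ j - 1) / 2 : ℕ) : ℤ))) : Set (Plaq (F.P Kt) 0)) εH U₀) →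
      ∃ H : (Fin (constrCard (Bj ν.M₁ Z k) k) → lieSU (Fin 2)) → PBond (F.P Kt) 0 → lieSU (Fin 2),
        (∀ v, fderiv ℝ (msChart F 2 Kt k (Bj ν.M₁ Z k) Wd U₀) 0 (H v) = v) ∧ ∀ v, Real.sqrt (∑ b, ‖H v b‖ ^ 2) ≤ B * ‖v‖)
    (hεH : ν.εreg ≤ εH)
    {W : MSField (F.P Kt) SU2} {U₀ : GaugeField (F.P Kt) 0 SU2}
    (hmin : IsMinimizerB (avOfRecord F 2 Kt) (regMSCoPOfRecord F 2 ν Kt k (maxDomT ν.M₁ Z)) (lamBondsSeq (maxDomT ν.M₁ Z) k) W U₀) :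
    Function.Surjective (fderiv ℝ (msChartB F 2 Kt k (lamBondsSeq (maxDomT ν.M₁ Z) k) W U₀) 0) :=
  surjective_fderiv_msChartB_lamBondsSeq_of_isMinimizerB_class_of_agreeOnB ν Kt Z hkK hM4 hdiv hε hsbU hερ hHB hεH hmin hmin.agreeOnB

/-- ★★ **`hsurj` FOR PRINT's CHART OF RECORD `msChartB F 2 Kt k (lamBondsSeq (maxDomT ν.M₁ Z) k) (M˙U₀) U₀`** at every class minimiser over any bond datum (base-point row `rfl`).
[cite: Balaban1984PropagatorsII, (2.3) p.224; Balaban1985Variational, Sect. C (44)–(48) p.285, (82)–(83) p.290; Balaban1988Convergent, (2.10)–(2.13) pp.256–257] -/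
theorem surjective_fderiv_msChartB_lamBondsSeq_of_isMinimizerB_class (ν : Node00.Stage7Numerics) (Kt : ℕ) (Z : Set (Site (F.P Kt) 0))
    (hkK : k + 1 ≤ (F.P Kt).m + (F.P Kt).K) (hM4 : 4 * (F.P Kt).L ≤ ν.M₁) (hdiv : side (F.P Kt).L ν.M₁ k ∣ (F.P Kt).sitesPerDir 0) (hε : 0 ≤ ν.εreg)
    {ρ'' : ℝ} (hsbU : ∀ V : GaugeField (F.P Kt) 0 SU2, ‖coeField V - 1‖ ≤ ρ'' → SmallBelow (avOfRecord F 2 Kt) k V)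
    (hερ : 6 * ((((F.P Kt).d - 1 : ℕ)) : ℝ) * (F.P Kt).L * ν.εreg ≤ ρ'')
    {εH B : ℝ}
    (hHB : ∀ (Wd : MSField (F.P Kt) SU2) (U₀ : GaugeField (F.P Kt) 0 SU2),
      AgreeOn (Bj ν.M₁ Z k) (avgFamily (avOfRecord F 2 Kt) U₀) Wd →
      (∀ i' : Fin (constrCard (Bj ν.M₁ Z k) k), ∃ U' : GaugeField (F.P Kt) 0 SU2,
        (∀ b ∈ feeds (((constrEnum (Bj ν.M₁ Z k) k).symm i').1 : ℕ) ((constrEnum (Bj ν.M₁ Z k) k).symm i').2.1, U' b = U₀ b) ∧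
          SmallBelow (avOfRecord F 2 Kt) k U') →
      (∀ (j : ℕ), 1 ≤ j → j ≤ k → ∀ y : Site (F.P Kt) j, embIter j y ∈ maxDomT ν.M₁ Z j → ∃ U' : GaugeField (F.P Kt) 0 SU2,
        (∀ c : PBond (F.P Kt) j, (c.src = y ∨ c.tgt = y) → ∀ b₀ : PBond (F.P Kt) 0,
          (iterBlockOf j b₀.src = c.src ∨ iterBlockOf j b₀.src = c.tgt) → (iterBlockOf j b₀.tgt = c.src ∨ iterBlockOf j b₀.tgt = c.tgt) → U' b₀ = U₀ b₀) ∧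
        SmallBelow (avOfRecord F 2 Kt) k U') →
      (∀ (j : ℕ), 1 ≤ j → j ≤ k → ∀ y : Site (F.P Kt) j, embIter j y ∈ maxDomT ν.M₁ Z j →
        PlaqSmallOn (boxPlaqs (fun κ => lift (F.P Kt) (embIter j y) κ - ((((F.P Kt).L ^ j : ℕ) : ℤ) + ((((F.P Kt).L ^ j - 1) / 2 : ℕ) : ℤ)))
          (fun κ => lift (F.P Kt) (embIter j y) κ + ((((F.P Kt).L ^ j : ℕ) : ℤ) + ((((F.P Kt).L ^ j - 1) / 2 : ℕ) : ℤ))) : Set (Plaq (F.P Kt) 0)) εH U₀) →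
      ∃ H : (Fin (constrCard (Bj ν.M₁ Z k) k) → lieSU (Fin 2)) → PBond (F.P Kt) 0 → lieSU (Fin 2),
        (∀ v, fderiv ℝ (msChart F 2 Kt k (Bj ν.M₁ Z k) Wd U₀) 0 (H v) = v) ∧ ∀ v, Real.sqrt (∑ b, ‖H v b‖ ^ 2) ≤ B * ‖v‖)
    (hεH : ν.εreg ≤ εH)
    {𝔅' : BDetSet (F.P Kt)} {W' : MSField (F.P Kt) SU2} {U₀ : GaugeField (F.P Kt) 0 SU2}
    (hmin : IsMinimizerB (avOfRecord F 2 Kt) (regMSCoPOfRecord F 2 ν Kt k (maxDomT ν.M₁ Z)) 𝔅' W' U₀) :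
    Function.Surjective (fderiv ℝ (msChartB F 2 Kt k (lamBondsSeq (maxDomT ν.M₁ Z) k) (avgFamily (avOfRecord F 2 Kt) U₀) U₀) 0) :=
  surjective_fderiv_msChartB_lamBondsSeq_of_isMinimizerB_class_of_agreeOnB ν Kt Z hkK hM4 hdiv hε hsbU hερ hHB hεH hmin fun _ _ _ => rfl

end Summit.QuantumFields.YangMills.BalabanUVNodes.N12HsurjOfClassLam
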